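import Summits.BirchSwinnertonDyer.Rank1Residual.Additive.TwistPartnerLevelOneTower
import Summits.BirchSwinnertonDyer.Rank1Residual.Additive.TwistPartnerForcedParity
import Literature.NumberTheory.EllipticCurves.PAdicLFunctionIntegralityAtTwoProofs
import HarnessLib

/-!
# A bounded measure with Delbourgo's rows FORCES tower boundedness of the forced twist partner
# (cell `b2b-bsdres`, sub-cell additive-p2 = X3♯(G-ord)/X4♯(G-ord), gen 25)

HONEST FRAMING (cell `b2b-bsdres`, run/shared/lean/b2b/bsd-rank1-residual/, verbatim in every
file): the goal of the cell is to DELETE the COMBINATION-SHAPED residual classes of the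
Birch–Swinnerton-Dyer formula for ALL analytic-rank `≤ 1` elliptic curves over `ℚ` — "full BSD
formula for every rank `≤ 1` curve in class `C`" assembled STRICTLY from published theorems — so
that the rank-`≤ 1` remainder becomes exactly the CONSTRUCTION-SHAPED classes, which are TYPED
(missing-input `Prop`s), NOT attempted. This is not "finishing BSD". Sub-cell additive-p2: the
classes X3♯(G-ord) / X4♯(G-ord) are CONSTRUCTION-SHAPED and stay so; labels / RESIDUAL-MAP marks
UNCHANGED; nothing is booked. ONE theorem (pure `p`-adic / character-sum analysis); no definition,
no named fact, no `sorry`.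

## What

Since gen 24 the ONE typed analytic input of the defect-3/4/6 tame-branch route is: the forced twist
partner `Φ = forced χ [·]⁺_f ã` (`TwistPartnerForced.lean`) is BOUNDED ON THE TOWER `{a/pⁿ}`. This file
derives that input from ANY family `μ n b ∈ ℂ_p` (`n ≥ 1`, `b mod pⁿ`) which is (i) bounded, (ii) a
distribution on the levels `n ≥ 1`, and (iii) has, against EVEN characters, the character integrals
of Delbourgo's `p`-adic `L`-function in E-normalised form — rows (W) (primitive, conductor `pⁿ`,
`n ≥ 2`), (T0), (T1), (Tε) (level `p^1`) — i.e. VERBATIM the clauses of the named fact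
`Literature.….Delbourgo1998.thm1_exists_bounded_evenMeasure` (Delbourgo 1998 Thm. 1) for the pair
`(χ, ã)`: **`TwistPartner.towerBounded_forced_of_measure`**. Mechanism: the measure `μ_Φ` of the
forced partner (`twistPartnerMeasure`, a distribution, `twistPartnerMeasure_distribution`) has the
SAME even rows ((W): `sum_mul_twistPartnerMeasure_eq`, cc-typer-2 gen 23; level one:
`TwistPartnerLevelOneTower.lean`) and is EVEN (`twistPartnerMeasure_forced_neg`: the plus symbol is
even), so `ν := μ + μ∘(−1) − 2μ_Φ` is a distribution on the levels `≥ 1` killed by every character of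
level `p^1` and by every PRIMITIVE character of level `pⁿ`, `n ≥ 2` (odd characters by reflection);
by induction on the level (an imprimitive character of level `p^{m+1}` is lifted from level `p^m`,
where `ν` vanishes on units, and the fibre sums of `ν` are its values one level down) and character
ORTHOGONALITY, `ν` vanishes on the units at every level: `2μ_Φ(b + pⁿℤ_p) = μ n b + μ n (−b)` is
bounded by `2C`, and `‖Φ(a/pⁿ)‖ = ‖μ_Φ(a + pⁿℤ_p)‖` for `p ∤ a` (other tower points reduce to lower
levels, down to `Φ(a) = Φ(0)`). So "tower boundedness" for Delbourgo's pair is a CONSEQUENCE of a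
named published theorem (consumer: `TwistPartnerForcedOfDelbourgo.lean`, same gen). Nothing booked.

References: B. Mazur, J. Tate, J. Teitelbaum, Invent. Math. 84 (1986) §I.8, §I.10 (10.1)
[MazurTateTeitelbaum1986Invent]; D. Delbourgo, Compositio Math. 113 (1998) Thm. 1 [Delbourgo1998].
-/

noncomputable section

open scoped Classical MatrixGroups ModularForm

open CongruenceSubgroup

namespace Summit.BirchSwinnertonDyer.Rank1Residual.Additive

open Literature.NumberTheory.EllipticCurves Literature.NumberTheory.EllipticCurves.ModularForms
  Literature.NumberTheory.EllipticCurves.Rank1Residual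

namespace TwistPartner

section Forced

variable {p : ℕ} [hp : Fact p.Prime] {N : ℕ} [NeZero N] {f : CuspForm (Gamma0 N) 2}
  {χ : MulChar (ZMod p) ℚ_[p]} {ã : ℚ_[p]}

/-- Reflected fibre sums: `∑_{c ↦ b} g(−c) = ∑_{c ↦ −b} g(c)` for the reduction `ℤ/p^{n+1} → ℤ/pⁿ`.
[folklore] -/
theorem sum_filter_castHom_neg {n : ℕ} (g : ZMod (p ^ (n + 1)) → ℂ_[p]) (b : ZMod (p ^ n)) :
    ∑ c ∈ Finset.univ.filter (fun c : ZMod (p ^ (n + 1)) ↦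
        ZMod.castHom (pow_dvd_pow p n.le_succ) (ZMod (p ^ n)) c = b), g (-c) =
      ∑ c ∈ Finset.univ.filter (fun c : ZMod (p ^ (n + 1)) ↦
        ZMod.castHom (pow_dvd_pow p n.le_succ) (ZMod (p ^ n)) c = -b), g c := by
  haveI : NeZero (p ^ (n + 1)) := ⟨pow_ne_zero _ hp.out.ne_zero⟩
  rw [Finset.sum_filter, Finset.sum_filter]
  refine Fintype.sum_equiv (Equiv.neg (ZMod (p ^ (n + 1)))) _ _ fun c ↦ ?_
  simp only [Equiv.neg_apply, map_neg, neg_neg, neg_eq_iff_eq_neg]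

/-- **A BOUNDED MEASURE WITH DELBOURGO'S ROWS FORCES TOWER BOUNDEDNESS OF THE FORCED PARTNER.**
Let `f` be a cusp form with `U_p[·]⁺_f = 0` (an ADDITIVE row), `χ ≠ 1` a character of `ℤ/p` with values
in `ℚ_p`, `ã` a unit, `ε₁` the lift of `ι ∘ χ` to level `p^1`. If some family `μ n b ∈ ℂ_p` is bounded,
is a distribution on the levels `n ≥ 1`, and has against EVEN characters the rows
(W) `ψ` primitive of conductor `pⁿ`, `n ≥ 2`: `ã^{−n}p⁻¹·(∑_t ιχ(t)ψ(1 + tp^{n−1}))·∑_b ψ(b)[b/pⁿ]⁺_f`,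
(T0) `ψ = 1` at level `p`: `ã⁻¹[0]⁺_f`, (T1) `ψ ∉ {1, ε₁}` at level `p`:
`ã⁻¹p⁻¹χ(−1)·J(ε₁, ψε₁⁻¹)·∑_b ψ(b)[b/p]⁺_f`, (Tε) `ψ = ε₁`: `(1 − ã⁻¹)(1 − ã/p)⁻¹p⁻¹χ(−1)·∑_b ε₁(b)[b/p]⁺_f`
— VERBATIM the clauses of `Delbourgo1998.thm1_exists_bounded_evenMeasure` for the pair `(χ, ã)` —
then the forced twist partner `forced χ [·]⁺_f ã` is BOUNDED ON THE TOWER `{a/pⁿ}`: the typed input of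
`exists_isTameBranchOf_riemannSum_of_towerBounded_forced` and of the gen-24 joins. Nothing booked.
[cite: Delbourgo1998, Theorem 1] [cite: MazurTateTeitelbaum1986Invent, §I.10 (10.1)] -/
theorem towerBounded_forced_of_measure (hχ : χ ≠ 1) (hã : ‖ã‖ = 1)
    (hU0 : ∀ s, ∑ d : ZMod p, ratPlusSymbol f (s + (d.val : ℚ) / p) = 0)
    {μ : (n : ℕ) → ZMod (p ^ n) → ℂ_[p]} {C : ℝ} (hbd : ∀ (n : ℕ) (b : ZMod (p ^ n)), ‖μ n b‖ ≤ C)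
    (hdist : ∀ (n : ℕ), 1 ≤ n → ∀ b : ZMod (p ^ n),
      ∑ c ∈ Finset.univ.filter (fun c : ZMod (p ^ (n + 1)) ↦
          ZMod.castHom (pow_dvd_pow p n.le_succ) (ZMod (p ^ n)) c = b), μ (n + 1) c = μ n b)
    (hW : ∀ (n : ℕ), 2 ≤ n → ∀ ψ : DirichletCharacter ℂ_[p] (p ^ n), ψ.IsPrimitive → ψ.Even →
      ∑ b : ZMod (p ^ n), ψ b * μ n b =
        algebraMap ℚ_[p] ℂ_[p] (ã⁻¹ ^ n * (p : ℚ_[p])⁻¹) *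
          (∑ t : ZMod p, algebraMap ℚ_[p] ℂ_[p] (χ t) *
            ψ (1 + ((t.val : ℕ) : ZMod (p ^ n)) * ((p : ZMod (p ^ n)) ^ (n - 1)))) *
          ratTwistedSymbolSum f ψ)
    (hT0 : ∑ b : ZMod (p ^ 1), (1 : DirichletCharacter ℂ_[p] (p ^ 1)) b * μ 1 b =
      algebraMap ℚ_[p] ℂ_[p] (ã⁻¹ * (ratPlusSymbol f 0 : ℚ_[p])))
    (hT1 : ∀ ψ : DirichletCharacter ℂ_[p] (p ^ 1), ψ.Even → ψ ≠ 1 →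
      ψ ≠ DirichletCharacter.changeLevel (dvd_pow_self p one_ne_zero)
        (χ.ringHomComp (algebraMap ℚ_[p] ℂ_[p])) →
      ∑ b : ZMod (p ^ 1), ψ b * μ 1 b =
        algebraMap ℚ_[p] ℂ_[p] (ã⁻¹ * (p : ℚ_[p])⁻¹ * χ (-1)) *
          jacobiSum (DirichletCharacter.changeLevel (dvd_pow_self p one_ne_zero)
              (χ.ringHomComp (algebraMap ℚ_[p] ℂ_[p])))
            (ψ * (DirichletCharacter.changeLevel (dvd_pow_self p one_ne_zero)
              (χ.ringHomComp (algebraMap ℚ_[p] ℂ_[p])))⁻¹) *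
          ratTwistedSymbolSum f ψ)
    (hTε : (DirichletCharacter.changeLevel (dvd_pow_self p one_ne_zero)
        (χ.ringHomComp (algebraMap ℚ_[p] ℂ_[p]))).Even →
      ∑ b : ZMod (p ^ 1), DirichletCharacter.changeLevel (dvd_pow_self p one_ne_zero)
          (χ.ringHomComp (algebraMap ℚ_[p] ℂ_[p])) b * μ 1 b =
        algebraMap ℚ_[p] ℂ_[p] ((1 - ã⁻¹) * (1 - ã / p)⁻¹ * (p : ℚ_[p])⁻¹ * χ (-1)) *
          ratTwistedSymbolSum f (DirichletCharacter.changeLevel (dvd_pow_self p one_ne_zero)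
            (χ.ringHomComp (algebraMap ℚ_[p] ℂ_[p])))) :
    ∃ C₀ : ℝ, ∀ (n : ℕ) (a : ℤ),
      ‖forced χ (fun r ↦ ((ratPlusSymbol f r : ℚ) : ℚ_[p])) ã ((a : ℚ) / (p : ℚ) ^ n)‖ ≤ C₀ := by
  haveI hne : ∀ n : ℕ, NeZero (p ^ n) := fun n ↦ ⟨pow_ne_zero _ hp.out.ne_zero⟩
  set ι : ℚ_[p] →+* ℂ_[p] := algebraMap ℚ_[p] ℂ_[p] with hι
  set ε₁ := DirichletCharacter.changeLevel (dvd_pow_self p one_ne_zero)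
    (χ.ringHomComp (algebraMap ℚ_[p] ℂ_[p])) with hε₁
  set x : ℚ → ℚ_[p] := fun r ↦ ((ratPlusSymbol f r : ℚ) : ℚ_[p]) with hxdef
  have hperx : ∀ s, x (s + 1) = x s := fun s ↦ by
    simp only [hxdef]
    rw [show (s + 1 : ℚ) = s + ((1 : ℤ) : ℚ) by push_cast; rfl, ratPlusSymbol_add_intCast_eq]
  have hevenx : ∀ s, x (-s) = x s := fun s ↦ by simp only [hxdef, ratPlusSymbol_neg]
  have hU0' : ∀ s, ∑ d : ZMod p, x (s + (d.val : ℚ) / p) = 0 := fun s ↦ by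
    simp only [hxdef]
    exact_mod_cast congrArg (fun q : ℚ ↦ (q : ℚ_[p])) (hU0 s)
  obtain ⟨hper', hx', hU'⟩ := forced_isPartner hχ hã hperx hU0'
  set Φ := forced χ x ã with hΦ
  have hã0 : ã ≠ 0 := fun h0 ↦ by rw [h0, norm_zero] at hã; exact zero_ne_one hã
  set μF := twistPartnerMeasure χ Φ ã (x 0) with hμF
  have hdistF := twistPartnerMeasure_distribution χ hã0 (fun s ↦ hx' s) hU'
  have hμFeven : ∀ (n : ℕ) (b : ZMod (p ^ (n + 1))), μF (n + 1) (-b) = μF (n + 1) b :=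
    fun n b ↦ twistPartnerMeasure_forced_neg hperx hevenx (x 0) n b
  -- the twisted symbol sums in the two currencies
  have hRTS : ∀ {n : ℕ} (ψ : DirichletCharacter ℂ_[p] (p ^ n)), ratTwistedSymbolSum f ψ =
      ∑ b : ZMod (p ^ n), ψ b * ι (x ((b.val : ℚ) / (p : ℚ) ^ n)) := fun ψ ↦ by
    unfold ratTwistedSymbolSum
    exact Finset.sum_congr rfl fun b _ ↦ by rw [hxdef, map_ratCast, Nat.cast_pow]
  -- the defect `ν = μ + μ∘(−1) − 2 μF` on the levels `n + 1`
  set ν : (n : ℕ) → ZMod (p ^ (n + 1)) → ℂ_[p] :=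
    fun n b ↦ μ (n + 1) b + μ (n + 1) (-b) - 2 * ι (μF (n + 1) b) with hν
  -- (A) the rows of `ν`: even characters see `2(∫ψ dμ − ∫ψ dμF)`, odd characters see `0`
  have hνrow : ∀ (n : ℕ) (ψ : DirichletCharacter ℂ_[p] (p ^ (n + 1))),
      ∑ b, ψ b * ν n b = (1 + ψ (-1)) * ∑ b, ψ b * μ (n + 1) b -
        (1 + ψ (-1)) * ∑ b, ψ b * ι (μF (n + 1) b) := by
    intro n ψ
    have h1 := sum_mul_apply_neg_eq ψ (μ (n + 1))
    have h2 := sum_mul_apply_neg_eq ψ (fun b ↦ ι (μF (n + 1) b))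
    simp only [hμFeven] at h2
    simp only [hν, mul_sub, mul_add, Finset.sum_sub_distrib, Finset.sum_add_distrib, h1]
    rw [show ∑ b, ψ b * (2 * ι (μF (n + 1) b)) = 2 * ∑ b, ψ b * ι (μF (n + 1) b) by
      rw [Finset.mul_sum]; exact Finset.sum_congr rfl fun b _ ↦ by ring]
    linear_combination (-1 : ℂ_[p]) * h2
  have hνodd : ∀ (n : ℕ) (ψ : DirichletCharacter ℂ_[p] (p ^ (n + 1))), ψ.Odd →
      ∑ b, ψ b * ν n b = 0 := by
    intro n ψ hψ
    rw [hνrow, hψ]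
    ring
  -- (B) level one
  have hlev1 : ∀ ψ : DirichletCharacter ℂ_[p] (p ^ 1), ∑ b, ψ b * ν 0 b = 0 := by
    intro ψ
    rcases ψ.even_or_odd with he | ho
    · rw [hνrow, he]
      suffices h : ∑ b, ψ b * μ 1 b = ∑ b, ψ b * ι (μF 1 b) by rw [h]; ring
      by_cases h1 : ψ = 1
      · subst h1
        rw [hT0, hμF, twistPartnerMeasure_level_one_one χ ã (fun s ↦ hx' s)]
      · by_cases hε : ψ = ε₁
        · subst hε
          rw [hTε he, hμF, twistPartnerMeasure_level_one_self hχ hã hper' (fun s ↦ hx' s) hU', hRTS]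
        · rw [hT1 ψ he h1 hε, hμF,
            twistPartnerMeasure_level_one_of_ne hχ hper' (fun s ↦ hx' s) hU' ψ h1 hε, hRTS]
    · exact hνodd 0 ψ ho
  -- (C) primitive characters at the levels `n + 1 ≥ 2`
  have hprim : ∀ (n : ℕ), 1 ≤ n → ∀ ψ : DirichletCharacter ℂ_[p] (p ^ (n + 1)), ψ.IsPrimitive →
      ∑ b, ψ b * ν n b = 0 := by
    intro n hn ψ hψ
    rcases ψ.even_or_odd with he | ho
    · rw [hνrow, he]
      suffices h : ∑ b, ψ b * μ (n + 1) b = ∑ b, ψ b * ι (μF (n + 1) b) by rw [h]; ring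
      rw [hW (n + 1) (by omega) ψ hψ he, hμF,
        sum_mul_twistPartnerMeasure_eq (by omega) hχ hper' (fun s ↦ hx' s) hψ]
      rfl
    · exact hνodd n ψ ho
  -- (D) induction on the level: `ν` vanishes on the units
  have hmain : ∀ (n : ℕ) (u : ZMod (p ^ (n + 1))), IsUnit u → ν n u = 0 := by
    intro n
    induction n with
    | zero => intro u hu; exact apply_eq_zero_of_forall_sum_mul_eq_zero hlev1 hu
    | succ m ih =>
      intro u hu
      refine apply_eq_zero_of_forall_sum_mul_eq_zero (fun ψ ↦ ?_) hu
      by_cases hψ : ψ.IsPrimitive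
      · exact hprim (m + 1) (by omega) ψ hψ
      · obtain ⟨ψ', rfl⟩ := exists_eq_changeLevel_of_not_isPrimitive hψ
        -- fibre sums: `∑_b ψ'(b̄) ν_{m+1}(b) = ∑_a ψ'(a) ν_m(a) = 0`
        set π := ZMod.castHom (pow_dvd_pow p (m + 1).le_succ) (ZMod (p ^ (m + 1))) with hπ
        have happ : ∀ b : ZMod (p ^ (m + 1 + 1)),
            DirichletCharacter.changeLevel (pow_dvd_pow p (m + 1).le_succ) ψ' b = ψ' (π b) :=
          fun b ↦ changeLevel_pow_apply (by omega) (by omega) ψ' b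
        simp_rw [happ]
        rw [← Finset.sum_fiberwise Finset.univ π]
        have hfib : ∀ a : ZMod (p ^ (m + 1)),
            ∑ b ∈ Finset.univ.filter (fun b ↦ π b = a), ψ' (π b) * ν (m + 1) b =
              ψ' a * ν m a := by
          intro a
          have h1 : ∑ b ∈ Finset.univ.filter (fun b ↦ π b = a), ψ' (π b) * ν (m + 1) b =
              ψ' a * ∑ b ∈ Finset.univ.filter (fun b ↦ π b = a), ν (m + 1) b := by
            rw [Finset.mul_sum]
            refine Finset.sum_congr rfl fun b hb ↦ ?_
            rw [(Finset.mem_filter.mp hb).2]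
          rw [h1]
          congr 1
          simp only [hν, Finset.sum_sub_distrib, Finset.sum_add_distrib]
          rw [hdist (m + 1) (by omega) a, sum_filter_castHom_neg (fun c ↦ μ (m + 1 + 1) c) a,
            hdist (m + 1) (by omega) (-a), ← Finset.mul_sum, ← map_sum, hdistF (m + 1) a]
        simp_rw [hfib]
        refine Finset.sum_eq_zero fun a _ ↦ ?_
        by_cases ha : IsUnit a
        · rw [ih a ha, mul_zero]
        · rw [MulChar.map_nonunit _ ha, zero_mul]
  -- (E) the measure of the forced partner is bounded on units of every level `n + 1`
  have hμFbd : ∀ (n : ℕ) (u : ZMod (p ^ (n + 1))), IsUnit u →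
      ‖μF (n + 1) u‖ ≤ ‖(2 : ℂ_[p])⁻¹‖ * (C + C) := by
    intro n u hu
    have h0 := hmain n u hu
    simp only [hν, sub_eq_zero] at h0
    have h1 : ι (μF (n + 1) u) = (2 : ℂ_[p])⁻¹ * (μ (n + 1) u + μ (n + 1) (-u)) := by
      rw [h0]; field_simp
    rw [← norm_algebraMap' ℂ_[p] (μF (n + 1) u), show algebraMap ℚ_[p] ℂ_[p] = ι from rfl, h1,
      norm_mul]
    exact mul_le_mul_of_nonneg_left ((norm_add_le _ _).trans (add_le_add (hbd _ _) (hbd _ _)))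
      (norm_nonneg _)
  -- (F) the tower bound: units read `μF`, multiples of `p` descend, integers read `Φ(0)`
  refine ⟨max ‖Φ 0‖ (‖(2 : ℂ_[p])⁻¹‖ * (C + C)), fun n ↦ ?_⟩
  induction n with
  | zero =>
    intro a
    rw [pow_zero, div_one, show ((a : ℤ) : ℚ) = 0 + (a : ℤ) by rw [zero_add],
      apply_add_intCast_of_periodic hper' 0 a]
    exact le_max_left _ _
  | succ n ih =>
    intro a
    by_cases hpa : (p : ℤ) ∣ a
    · obtain ⟨a', rfl⟩ := hpa
      have h : (((p : ℤ) * a' : ℤ) : ℚ) / (p : ℚ) ^ (n + 1) = (a' : ℚ) / (p : ℚ) ^ n := by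
        have hp0 : (p : ℚ) ≠ 0 := Nat.cast_ne_zero.mpr hp.out.ne_zero
        push_cast
        rw [pow_succ]
        field_simp
      rw [h]
      exact ih a'
    · -- `a` is a unit mod `p^{n+1}`; `Φ(a/p^{n+1}) = Φ(b.val/p^{n+1})` for `b = a mod p^{n+1}`
      have hu : IsUnit ((a : ZMod (p ^ (n + 1)))) := isUnit_intCast_of_not_dvd hpa (n + 1)
      set b : ZMod (p ^ (n + 1)) := (a : ZMod (p ^ (n + 1))) with hb
      have hval : ((b.val : ℤ) : ℤ) = a % (p ^ (n + 1) : ℕ) := by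
        rw [hb, ZMod.val_intCast]
      have hΦeq : Φ ((a : ℚ) / (p : ℚ) ^ (n + 1)) = Φ ((b.val : ℚ) / (p : ℚ) ^ (n + 1)) := by
        have hp0 : ((p : ℚ) ^ (n + 1)) ≠ 0 := pow_ne_zero _ (Nat.cast_ne_zero.mpr hp.out.ne_zero)
        set q : ℤ := a / (p ^ (n + 1) : ℕ) with hqdef
        have hz : (b.val : ℤ) + (p ^ (n + 1) : ℕ) * q = a := by
          rw [hval, hqdef]; exact Int.emod_add_mul_ediv a _
        have hzq : (b.val : ℚ) + (p : ℚ) ^ (n + 1) * (q : ℚ) = (a : ℚ) := by exact_mod_cast hz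
        have hdiv : (a : ℚ) / (p : ℚ) ^ (n + 1) = (b.val : ℚ) / (p : ℚ) ^ (n + 1) + (q : ℚ) := by
          rw [← hzq, add_div, mul_div_cancel_left₀ _ hp0]
        rw [hdiv, apply_add_intCast_of_periodic hper']
      have hμval : μF (n + 1) b = ã⁻¹ ^ (n + 1) * χ⁻¹ ((b.val : ℕ) : ZMod p) *
          Φ ((b.val : ℚ) / (p : ℚ) ^ (n + 1)) := twistPartnerMeasure_succ χ Φ ã (x 0) n b
      have hub : IsUnit (((b.val : ℕ) : ZMod p)) := by
        have h := (isUnit_iff_isUnit_cast (p := p) (m := n + 1) (by omega) b).mp hu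
        rwa [ZMod.castHom_apply, ZMod.cast_eq_val] at h
      have hnorm : ‖Φ ((a : ℚ) / (p : ℚ) ^ (n + 1))‖ = ‖μF (n + 1) b‖ := by
        rw [hΦeq, hμval, norm_mul, norm_mul, norm_pow, norm_inv, hã, inv_one, one_pow, one_mul,
          norm_apply_eq_one_of_isUnit χ⁻¹ hub, one_mul]
      rw [hnorm]
      exact (hμFbd n b hu).trans (le_max_right _ _)

end Forced

end TwistPartner

end Summit.BirchSwinnertonDyer.Rank1Residual.Additive

end
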